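import Literature.Algebra.Lie.ChevalleyEilenbergWedgeOne
import Literature.Algebra.Lie.ChevalleyEilenbergCasimirHomotopy
import HarnessLib

/-!
# The basic projector for a central element: `B = 1 - α ∧ i_z` (Borel–Wallach I 1.3, cochain level)

Topic `Algebra/Lie`; namespace `Literature.Algebra.Lie.ChevalleyEilenberg` (the vocabulary of
`ChevalleyEilenbergComplex` / `ChevalleyEilenbergWedgeOne`: cochains `Cochain R L M q`, `d`, `ins`, `lieDer`,
the wedge `wedgeOne M α q : C^q → C^{q+1}` with a `1`-form `α : L →ₗ[R] R`, relative complexes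
`Subcomplex.gK R L M K A`).  Definitions with bodies and theorems only (no named fact, no `sorry`).

SETTING [cite: BorelWallach2000, I §1.3]: `z ∈ L` is CENTRAL (`⁅z, x⁆ = 0`), `α` is a `1`-form vanishing on
brackets (`dα = 0`) with `α(z) = 1` (so `L = ker α ⊕ R z` as Lie algebras).  In print this gives the Künneth
splitting `H^•(L; M) = H^•(L/Rz; M) ⊗ Λ^•(Rz)^*` when `z` acts trivially on `M`; here we record its
cochain-level mechanism and the consequence actually used for `(𝔤, K)`-cohomology of `GL_n`
(`NumberTheory/Automorphic/ResGLnCuspidalCohomologyApexBasic`): a non-trivial class can be replaced by a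
BASIC one (`i_z η = 0`), possibly one degree lower.

* `basicProj α z q : C^{q+1} → C^{q+1}`, `B f = f - α ∧ i_z f` — the projector onto basic cochains:
  `i_z (B f) = 0` (`ins_basicProj`, from `i_z (α ∧ i_z f) = i_z f`), `B f = f` for basic `f`, `B ∘ B = B`;
* `d_ins_eq_neg_ins_d` — `d i_z f = -i_z d f` when `θ_z f = 0` (Cartan `θ_z = i_z d + d i_z`
  [cite: BorelWallach2000, I §1.1 (5)]); hence **`B` is a cochain map when `θ_z = 0`** (`d_basicProj`, with
  `d (α ∧ g) = -α ∧ dg`);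
* `lieDer_eq_smul_of_central`, `smul_eq_d_ins` — if the central `z` acts on `M` by a scalar `c` (for extra
  scalars `A`, e.g. `A = ℂ` on a complex representation of a real Lie algebra) then `θ_z = c` on cochains and,
  for a cocycle `f`, `c • f = d (i_z f)`: **a cocycle which is not a coboundary forces `c = 0`**;
* `map_basicProj`, `basicProj_mem_gK` — `B` is natural in `M` and preserves the relative complex
  `C^•(L, K; M)^Γ` of a pair action fixing `z` and `α` (`α|_K = 0`);
* `exists_basic_of_not_coboundary` — **the reduction**: for a predicate `Pr` on cochains stable under
  differences, `A`-scalars, `i_z` and `α ∧ -` (e.g. "level-fixed"), a `Pr`-cocycle `η` of degree `q + 2` of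
  `C^•(L, K; M)^Γ` which is not the coboundary of a `Pr`-cochain of the complex yields a BASIC such cocycle,
  namely `B η` (degree `q + 2`) or `i_z η` (degree `q + 1`): if `B η = dβ₀` and `i_z η = dδ` then
  `η = B η + α ∧ i_z η = d (B β₀ - α ∧ δ)`.

## References

* A. Borel, N. Wallach, *Continuous cohomology, discrete subgroups, and representations of reductive
  groups*, 2nd ed., AMS (2000), I §1.1 (5), I §1.3. [BorelWallach2000]
* C. Chevalley, S. Eilenberg, *Cohomology theory of Lie groups and Lie algebras*, Trans. AMS 63 (1948),
  §24 (the operations `i`, `θ`). [ChevalleyEilenberg1948]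
-/

open Fin Function

namespace Literature.Algebra.Lie.ChevalleyEilenberg

variable {R : Type*} [CommRing R] {L : Type*} [LieRing L] [LieAlgebra R L]
  {M : Type*} [AddCommGroup M] [Module R M] (α : L →ₗ[R] R) (z : L)

/-! ### The projector `B = 1 - α ∧ i_z` -/

section Projector

/-- **The basic projector** `B f = f - α ∧ i_z f` on `(q+1)`-cochains. [cite: BorelWallach2000, I §1.3] -/
def basicProj (q : ℕ) : Cochain R L M (q + 1) →ₗ[R] Cochain R L M (q + 1) :=
  LinearMap.id - wedgeOne M α q ∘ₗ ins q z

/-- Unfolding. [folklore] -/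
theorem basicProj_apply (q : ℕ) (f : Cochain R L M (q + 1)) :
    basicProj α z q f = f - wedgeOne M α q (ins q z f) :=
  rfl

/-- `i_z (α ∧ i_z f) = i_z f` when `α(z) = 1` (`i_z (α ∧ g) = α(z) g - α ∧ i_z g`, `i_z i_z = 0`).
[cite: BorelWallach2000, I §1.3] -/
theorem ins_wedgeOne_ins (hz : α z = 1) :
    ∀ (q : ℕ) (f : Cochain R L M (q + 1)), ins q z (wedgeOne M α q (ins q z f)) = ins q z f
  | 0, f => by rw [ins_wedgeOne_zero, hz, one_smul]
  | q + 1, f => by rw [ins_wedgeOne_succ, hz, one_smul, ins_self, map_zero, sub_zero]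

/-- **`B f` is basic**: `i_z (B f) = 0`. [cite: BorelWallach2000, I §1.3] -/
theorem ins_basicProj (hz : α z = 1) (q : ℕ) (f : Cochain R L M (q + 1)) : ins q z (basicProj α z q f) = 0 := by
  rw [basicProj_apply, map_sub, ins_wedgeOne_ins α z hz, sub_self]

/-- `B f = f` for a basic `f`. [folklore] -/
theorem basicProj_eq_self {q : ℕ} {f : Cochain R L M (q + 1)} (hf : ins q z f = 0) : basicProj α z q f = f := by
  rw [basicProj_apply, hf, map_zero, sub_zero]

/-- `B ∘ B = B`. [folklore] -/
theorem basicProj_basicProj (hz : α z = 1) (q : ℕ) (f : Cochain R L M (q + 1)) :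
    basicProj α z q (basicProj α z q f) = basicProj α z q f :=
  basicProj_eq_self α z (ins_basicProj α z hz q f)

/-- `B` is linear for extra scalars acting through `L`-module endomorphisms. [folklore] -/
theorem basicProj_smul' {A : Type*} [CommRing A] [Module A M] [SMulCommClass R A M] [LieRingModule L M]
    [LieSMulComm A L M] (a : A) (q : ℕ) (f : Cochain R L M (q + 1)) :
    basicProj α z q (a • f) = a • basicProj α z q f := by
  rw [basicProj_apply, basicProj_apply, ins_smul', wedgeOne_smul', smul_sub]

variable {M' : Type*} [AddCommGroup M'] [Module R M']

/-- **Naturality**: `B` commutes with the cochain maps `φ_*` of `L`-module morphisms. [folklore] -/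
theorem map_basicProj [LieRingModule L M] [LieRingModule L M'] (φ : M →ₗ⁅R,L⁆ M') (q : ℕ)
    (f : Cochain R L M (q + 1)) :
    map L φ (q + 1) (basicProj α z q f) = basicProj α z q (map L φ (q + 1) f) := by
  rw [basicProj_apply, basicProj_apply, map_sub, map_wedgeOne, ← ins_map]

end Projector

/-! ### Cartan: `θ_z = i_z d + d i_z`, central `z` -/

section Cartan

variable [LieRingModule L M] [LieModule R L M]

/-- `d (i_z f) = -i_z (d f)` when `θ_z f = 0`. [cite: BorelWallach2000, I §1.1 (5)] -/
theorem d_ins_eq_neg_ins_d (q : ℕ) (f : Cochain R L M (q + 1)) (hθ : lieDer R L M (q + 1) z f = 0) :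
    d R L M q (ins q z f) = -ins (q + 1) z (d R L M (q + 1) f) := by
  have h := lieDer_eq_ins_d_add_d_ins q z f
  rw [hθ] at h
  exact eq_neg_of_add_eq_zero_right h.symm

/-- **`B` is a cochain map when `θ_z = 0`**: `d (B f) = d f + α ∧ d (i_z f) = d f - α ∧ i_z (d f) = B (d f)`
(`α` vanishing on brackets). [cite: BorelWallach2000, I §1.3] -/
theorem d_basicProj (hα : ∀ x y : L, α ⁅x, y⁆ = 0) (hθ : ∀ (q : ℕ) (g : Cochain R L M q), lieDer R L M q z g = 0)
    (q : ℕ) (f : Cochain R L M (q + 1)) :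
    d R L M (q + 1) (basicProj α z q f) = basicProj α z (q + 1) (d R L M (q + 1) f) := by
  rw [basicProj_apply, basicProj_apply, map_sub, d_wedgeOne α hα, d_ins_eq_neg_ins_d z q f (hθ _ _), map_neg,
    neg_neg]

/-- For a CENTRAL `z` acting on `M` by the scalar `c` (extra scalars `A`), **`θ_z = c` on cochains**
(`θ_z` is post-composition with the action of `z`). [cite: BorelWallach2000, I §1.1] -/
theorem lieDer_eq_smul_of_central {A : Type*} [Monoid A] [DistribMulAction A M] [SMulCommClass R A M]
    (hz : ∀ x : L, ⁅z, x⁆ = 0) {c : A} (hc : ∀ m : M, ⁅z, m⁆ = c • m) (q : ℕ) (f : Cochain R L M q) :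
    lieDer R L M q z f = c • f := by
  rw [lieDer_eq_post_toEnd_of_central hz q f]
  refine AlternatingMap.ext fun v => ?_
  rw [post_apply, AlternatingMap.smul_apply, LieModule.toEnd_apply_apply, hc]

/-- **Cartan**: if `θ_z = c` on cochains then `c • f = d (i_z f)` for every cocycle `f`; in particular a
cocycle which is not a coboundary (in a complex stable under `i_z` and the scalars) forces `c = 0`.
[cite: BorelWallach2000, I §1.1 (5), I §1.3] -/
theorem smul_eq_d_ins {A : Type*} [Monoid A] [DistribMulAction A M] [SMulCommClass R A M] {c : A}
    (hc : ∀ (q : ℕ) (f : Cochain R L M q), lieDer R L M q z f = c • f) {q : ℕ} {f : Cochain R L M (q + 1)}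
    (hf : d R L M (q + 1) f = 0) : c • f = d R L M q (ins q z f) := by
  rw [← hc, lieDer_eq_ins_d_add_d_ins, hf, map_zero, zero_add]

end Cartan

/-! ### The relative complex and the reduction to basic classes -/

section Relative

variable [LieRingModule L M] [LieModule R L M] {Γ : Type*} [Group Γ]

/-- **`B` preserves the relative complex `C^•(L, K; M)^Γ`** when `α|_K = 0`, `dα = 0`, `α` is `Γ`-invariant,
`z` is central and `Γ`-fixed. [cite: BorelWallach2000, I §1.3] -/
theorem basicProj_mem_gK (K : LieSubalgebra R L) (P : PairAction R L M Γ) (hαK : ∀ x ∈ K, α x = 0)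
    (hα : ∀ x y : L, α ⁅x, y⁆ = 0) (hαP : ∀ (g : Γ) (x : L), α (P.σ g x) = α x) (hz : ∀ x : L, ⁅z, x⁆ = 0)
    (hzP : ∀ g : Γ, P.σ g z = z) (q : ℕ) (f : Cochain R L M (q + 1))
    (hf : f ∈ (Subcomplex.gK R L M K P).carrier (q + 1)) :
    basicProj α z q f ∈ (Subcomplex.gK R L M K P).carrier (q + 1) :=
  Submodule.sub_mem _ hf (wedgeOne_mem_gK α K P hαK hα hαP q _ (ins_mem_gK_of_central K P hz hzP q f hf))

/-- **The basic reduction** (cochain form of the Künneth splitting for the central line `R z`).  Let `z` be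
central and `Γ`-fixed, acting on `M` by a scalar `c ∈ 𝕜` (a field of extra scalars); let `α` vanish on `K`
and on brackets, be `Γ`-invariant, with `α(z) = 1`; let `Pr` be a property of cochains stable under
differences, `𝕜`-scalars, `i_z` and `α ∧ -`.  If `η` is a `Pr`-cocycle of degree `q + 2` of
`C^•(L, K; M)^Γ` which is not the coboundary of a `Pr`-cochain of the complex, then (Cartan) `c = 0`,
`θ_z = 0`, `B` is a cochain map, and either `B η` (degree `q + 2`) or `i_z η` (degree `q + 1`) is a BASIC
`Pr`-cocycle of the complex which is not the coboundary of a `Pr`-cochain of the complex: were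
`B η = dβ₀` and `i_z η = dδ`, then `η = B η + α ∧ i_z η = d(B β₀ - α ∧ δ)`. [cite: BorelWallach2000, I §1.3] -/
theorem exists_basic_of_not_coboundary {𝕜 : Type*} [Field 𝕜] [Module 𝕜 M] [SMulCommClass R 𝕜 M]
    [LieSMulComm 𝕜 L M] (K : LieSubalgebra R L) (P : PairAction R L M Γ) [P.SMulComm 𝕜]
    (hαK : ∀ x ∈ K, α x = 0) (hα : ∀ x y : L, α ⁅x, y⁆ = 0) (hαP : ∀ (g : Γ) (x : L), α (P.σ g x) = α x)
    (hz : ∀ x : L, ⁅z, x⁆ = 0) (hzP : ∀ g : Γ, P.σ g z = z) (hz1 : α z = 1) {c : 𝕜} (hc : ∀ m : M, ⁅z, m⁆ = c • m)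
    (Pr : ∀ q : ℕ, Cochain R L M q → Prop)
    (Pr_sub : ∀ (q : ℕ) (f g : Cochain R L M q), Pr q f → Pr q g → Pr q (f - g))
    (Pr_smul : ∀ (q : ℕ) (a : 𝕜) (f : Cochain R L M q), Pr q f → Pr q (a • f))
    (Pr_ins : ∀ (q : ℕ) (f : Cochain R L M (q + 1)), Pr (q + 1) f → Pr q (ins q z f))
    (Pr_wedge : ∀ (q : ℕ) (f : Cochain R L M q), Pr q f → Pr (q + 1) (wedgeOne M α q f))
    {q : ℕ} {η : Cochain R L M (q + 2)} (hη : η ∈ (Subcomplex.gK R L M K P).cocycles (q + 2)) (hPη : Pr (q + 2) η)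
    (hne : ∀ β ∈ (Subcomplex.gK R L M K P).carrier (q + 1), Pr (q + 1) β → d R L M (q + 1) β ≠ η) :
    ∃ (q' : ℕ) (η' : Cochain R L M (q' + 1)),
      η' ∈ (Subcomplex.gK R L M K P).cocycles (q' + 1) ∧ Pr (q' + 1) η' ∧ ins q' z η' = 0 ∧
        ∀ β ∈ (Subcomplex.gK R L M K P).carrier q', Pr q' β → d R L M q' β ≠ η' := by
  obtain ⟨hηmem, hdη⟩ := ((Subcomplex.gK R L M K P).mem_cocycles_iff (q + 2) η).1 hη
  have hPB : ∀ (q : ℕ) (f : Cochain R L M (q + 1)), Pr (q + 1) f → Pr (q + 1) (basicProj α z q f) :=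
    fun q f hf => by
      rw [basicProj_apply]
      exact Pr_sub _ _ _ hf (Pr_wedge _ _ (Pr_ins _ _ hf))
  have hθc : ∀ (q : ℕ) (f : Cochain R L M q), lieDer R L M q z f = c • f := lieDer_eq_smul_of_central z hz hc
  -- Step 1 (Cartan): the scalar `c` vanishes, so `θ_z = 0` on cochains
  have hcη : c • η = d R L M (q + 1) (ins (q + 1) z η) := smul_eq_d_ins z hθc hdη
  have hc0 : c = 0 := by
    by_contra hc0
    refine hne (c⁻¹ • ins (q + 1) z η)
      (Subcomplex.SMulStable.smul_mem _ _ _ (ins_mem_gK_of_central K P hz hzP _ η hηmem))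
      (Pr_smul _ _ _ (Pr_ins _ η hPη)) ?_
    rw [d_smul, ← hcη, smul_smul, inv_mul_cancel₀ hc0, one_smul]
  have hθ : ∀ (q : ℕ) (g : Cochain R L M q), lieDer R L M q z g = 0 := fun q g => by rw [hθc, hc0, zero_smul]
  -- `i_z η` is a cocycle of the complex
  have hdins : d R L M (q + 1) (ins (q + 1) z η) = 0 := by
    rw [d_ins_eq_neg_ins_d z (q + 1) η (hθ _ _), hdη, map_zero, neg_zero]
  -- Step 2: case analysis on the basic part `B η`
  by_cases hB : ∃ β ∈ (Subcomplex.gK R L M K P).carrier (q + 1), Pr (q + 1) β ∧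
      d R L M (q + 1) β = basicProj α z (q + 1) η
  · -- `B η` is a `Pr`-coboundary: output `i_z η` in degree `q + 1`
    obtain ⟨β₀, hβ₀, hPβ₀, hdβ₀⟩ := hB
    refine ⟨q, ins (q + 1) z η, ((Subcomplex.gK R L M K P).mem_cocycles_iff (q + 1) _).2
        ⟨ins_mem_gK_of_central K P hz hzP _ η hηmem, hdins⟩, Pr_ins _ η hPη, ins_self q z η,
      fun δ hδ hPδ hdδ => ?_⟩
    refine hne (basicProj α z q β₀ - wedgeOne M α q δ)
      (Submodule.sub_mem _ (basicProj_mem_gK α z K P hαK hα hαP hz hzP q β₀ hβ₀)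
        (wedgeOne_mem_gK α K P hαK hα hαP q δ hδ))
      (Pr_sub _ _ _ (hPB _ _ hPβ₀) (Pr_wedge _ _ hPδ)) ?_
    rw [map_sub, d_basicProj α z hα hθ, hdβ₀, basicProj_basicProj α z hz1, d_wedgeOne α hα, hdδ, sub_neg_eq_add,
      basicProj_apply, sub_add_cancel]
  · -- `B η` is not a `Pr`-coboundary: output `B η` in degree `q + 2`
    push Not at hB
    refine ⟨q + 1, basicProj α z (q + 1) η, ((Subcomplex.gK R L M K P).mem_cocycles_iff (q + 2) _).2
        ⟨basicProj_mem_gK α z K P hαK hα hαP hz hzP _ η hηmem, ?_⟩,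
      hPB _ _ hPη, ins_basicProj α z hz1 _ _, hB⟩
    rw [d_basicProj α z hα hθ, hdη, map_zero]

end Relative

end Literature.Algebra.Lie.ChevalleyEilenberg
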